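import Summits.BirchSwinnertonDyer.BirchSwinnertonDyer.Theorems.QuadraticBranchSignedControlPlusEtaNonsurjCartanField
import Literature.NumberTheory.EllipticCurves.Kato2004.IwasawaH1Reduction
import Literature.NumberTheory.EllipticCurves.FrobeniusTateModuleProofs
import Literature.NumberTheory.EllipticCurves.ModPIrreducibleCongruenceTransferProofs
import Literature.NumberTheory.EllipticCurves.TateModuleProjSurjectiveProofs
import Literature.NumberTheory.EllipticCurves.TateModuleFree
import HarnessLib

/-!
# Route `QuadraticBranchSignedControl` (rung K8, cell `bsd-potss`): crux stmt-BirchSwinnertonDyer-19606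
# `PlusEtaMainConjectureNonsurj` — KATO'S INTEGRAL CLAUSE IS IDLE ON EVERY ROW: hypothesis (3) of
# `Kato2004.thm13_4_lengthAt_fineSelmerDual_le_of_isEulerSystemClass` is UNSATISFIABLE when `Im ρ̄_{V,p} = C_ns⁺(p)`

WHAT. Kato's Euler-system bound (Astérisque 295, Thm. 13.4), as vendored in the tree
(`Kato2004.thm13_4_lengthAt_fineSelmerDual_le_of_isEulerSystemClass`, p. 226), has an INTEGRAL clause (3) — the bound at
EVERY height-one prime, including `(p)` — under the hypothesis «`W[p]` irreducible and there is
`σ ∈ Gal(ℚ̄/ℚ(μ_{p^∞}))` with `T_pW/(ρ(σ) − 1) ≅ ℤ_p` (free of rank one)». Seat k8q-c2x g5 discharged the weaker hypothesis (v)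
of clause (2) (away from `p`) for every non-CM curve (p562088). THIS FILE proves that the hypothesis of clause (3) FAILS on
every row of crux 19606 (CM or not): for `V/ℚ` globally minimal, `p ≥ 5` good with `a_p = 0` and `p`-adic tower not onto —
equivalently `Im ρ̄_{V,p} = C_ns⁺(p)` — there is NO `σ` fixing `μ_{p^∞}` with `T_pV/(ρ(σ) − 1)T_pV ≃ ℤ_p`
(`not_exists_katoClauseThree_of_row`). So the `pⁿ` of Kobayashi's Thm. 4.1 on these rows cannot be removed by Kato's
machine as printed: the crux's `why_might_fail` («non-surjective rows keep the pⁿ-slack») is a THEOREM about the named fact's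
own binder.

PROOF. `σ` fixes `μ_{p^∞}` ⟹ `χ_p(σ) = 1` (`cyclotomicCharacter_eq_one_of_forall_pow_eq_one`) ⟹ `det ρ_{T_pV}(σ) = 1` (Weil
pairing, `det_galoisRepTate_eq_cyclotomicCharacter_holds`) ⟹ `det ρ̄(σ) = 1` on `V[p]`
(`det_galoisRepTorsion_eq_toZMod_det_galoisRepTate`). §1: an element of `C_ns⁺(ε)` of determinant `1` is either `1` or has
`M − 1` INVERTIBLE (`det(M − 1) = 2 − tr M` and the no-transvection analysis; `p ≠ 2`). §3, with `T = T_pV`, `N = (ρ(σ)−1)T`,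
`T → V[p]` the reduction (`Kato2004.tateModP`: onto, kernel `pT`): (i) if `ρ̄(σ) = 1` then `N ⊆ pT`, so `T/N ≅ ℤ_p` surjects
onto `T/pT = V[p]`, of order `p²` — but an additive image of `ℤ_p` in a group of exponent `p` has at most `p` elements;
(ii) if `ρ̄(σ) − 1` is invertible then `T = N + pT`, so `T/N = p·(T/N)`, i.e. `ℤ_p = pℤ_p` — but `p` is not a unit.

* §1 `eq_one_or_isUnit_sub_one_of_det_eq_one` (matrix algebra); §2 `det_matrix_eq_one_of_forall_pow_eq_one` (fixing
  `μ_{p^∞}` forces determinant `1` on `V[p]`), `smul_eq_self_or_exists_sub_eq_of_forall_pow_eq_one` (dichotomy on `V[p]`);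
  §3 `card_le_of_addMonoidHom_surjective` (additive images of `ℤ_p` in groups of exponent `p`),
  **`not_exists_katoClauseThree`** (frame form) and **`not_exists_katoClauseThree_of_row`** (hypotheses of the crux).

HONEST FRAMING (cell `bsd-potss`, run/shared/lean/pub/bsd-potss/; FULL-BSD rank ≤ 1 programme): TOOL THEOREMS ONLY (no
definition, no named fact, no `sorry`, axioms standard). A NEGATIVE structural statement about the applicability of ONE
printed theorem's integral clause; it does not refute the crux and books nothing; crux 19606 stays OPEN; `BSD(W, p)` is
claimed for no pair. Seat `bsd-potss-k8eta-c2` g9 (prover), `--supports stmt-BirchSwinnertonDyer-19606`.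

References: [Kato2004Asterisque] Thm. 13.4 (3) and the remark after it (p. 226), §13.8; [Serre1972] §2.2;
[SilvermanAEC2009] III.§7, III.8 (Weil pairing, `det ρ_ℓ = χ_ℓ`).
-/

set_option autoImplicit false
set_option linter.dupNamespace false

noncomputable section

open scoped Classical

open Matrix Field WeierstrassCurve Literature.NumberTheory.EllipticCurves Literature.NumberTheory.SerreUniformity
  Literature.NumberTheory.GaloisRepresentations Literature.NumberTheory.EllipticCurves.Kato2004

namespace Summit.BirchSwinnertonDyer.BirchSwinnertonDyer.Theorems.EtaCartanField

variable {p : ℕ} [hp : Fact p.Prime]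

/-! ## §1 Determinant-one elements of `C_ns⁺(ε)`: identity or `M − 1` invertible -/

omit hp in
/-- Two `2 × 2` matrix literals with equal entries are equal. [folklore] -/
private theorem mat_eq' {a b c d a' b' c' d' : ZMod p} (h₁ : a = a') (h₂ : b = b') (h₃ : c = c')
    (h₄ : d = d') :
    (!![a, b; c, d] : Matrix (Fin 2) (Fin 2) (ZMod p)) = !![a', b'; c', d'] := by
  subst h₁ h₂ h₃ h₄; rfl

/-- **A determinant-one element of `C_ns⁺(ε)` is the identity or has `M − 1` invertible** (`p` odd, `ε` a non-square):
for `M = (a, εb; b, a)` with `a² − εb² = 1`, `det(M − 1) = 2 − 2a` vanishes only at `a = 1`, where `εb² = 0` forces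
`M = 1`; for `M = (c, −εd; d, −c)` with `−c² + εd² = 1`, `det(M − 1) = 2 ≠ 0`. [cite: Serre1972, §2.2] -/
theorem eq_one_or_isUnit_sub_one_of_det_eq_one (hp2 : p ≠ 2) {ε : ZMod p} (hε : ¬ IsSquare ε)
    {M : Matrix (Fin 2) (Fin 2) (ZMod p)} (hM : M ∈ nonsplitCartanNormalizer ε) (hdet : M.det = 1) :
    M = 1 ∨ IsUnit (M - 1) := by
  have h2 : (2 : ZMod p) ≠ 0 := Ring.two_ne_zero (by rw [ZMod.ringChar_zmod_n]; exact hp2)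
  have hε0 : ε ≠ 0 := fun h => hε ⟨0, by simp [h]⟩
  obtain ⟨a, b, hab, rfl | rfl⟩ := hM
  · rw [Matrix.det_fin_two_of] at hdet
    by_cases ha : a = 1
    · left
      subst ha
      have hb : b = 0 := by
        have : ε * (b * b) = 0 := by linear_combination -hdet
        rcases mul_eq_zero.mp this with h | h
        · exact absurd h hε0
        · exact mul_self_eq_zero.mp h
      subst hb
      rw [Matrix.one_fin_two]
      exact mat_eq' rfl (by ring) rfl rfl
    · right
      rw [Matrix.isUnit_iff_isUnit_det, Matrix.one_fin_two]
      have hsub : (!![a, ε * b; b, a] : Matrix (Fin 2) (Fin 2) (ZMod p)) - !![1, 0; 0, 1] =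
          !![a - 1, ε * b; b, a - 1] := by
        ext i j; fin_cases i <;> fin_cases j <;> simp
      rw [hsub, Matrix.det_fin_two_of]
      have hval : (a - 1) * (a - 1) - ε * b * b = 2 * (1 - a) := by linear_combination hdet
      rw [hval]
      exact (mul_ne_zero h2 (sub_ne_zero.mpr (Ne.symm ha))).isUnit
  · right
    rw [Matrix.det_fin_two_of] at hdet
    rw [Matrix.isUnit_iff_isUnit_det, Matrix.one_fin_two]
    have hsub : (!![a, -(ε * b); b, -a] : Matrix (Fin 2) (Fin 2) (ZMod p)) - !![1, 0; 0, 1] =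
        !![a - 1, -(ε * b); b, -a - 1] := by
      ext i j; fin_cases i <;> fin_cases j <;> simp
    rw [hsub, Matrix.det_fin_two_of]
    have hval : (a - 1) * (-a - 1) - -(ε * b) * b = 2 := by linear_combination hdet
    rw [hval]
    exact h2.isUnit

/-! ## §2 Fixing `μ_{p^∞}` forces determinant one on `V[p]`; the dichotomy on `V[p]` -/

section Torsion

variable (V : WeierstrassCurve ℚ) [V.IsElliptic]

/-- **`σ` fixes all `p`-power roots of unity ⟹ its matrix on `V[p]` has determinant `1`**: `χ_p(σ) = 1`
(`cyclotomicCharacter_eq_one_of_forall_pow_eq_one`), `det ρ_{T_pV}(σ) = χ_p(σ)` (Weil pairing,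
`det_galoisRepTate_eq_cyclotomicCharacter_holds`), reduction to `V[p]` (`det_galoisRepTorsion_eq_toZMod_det_galoisRepTate`),
and the determinant of the `𝔽_p`-linear map `σ` equals that of its matrix in any frame. [cite: SilvermanAEC2009, Prop. III.8.1 and III.8.3]
[cite: SerreAbelianLadic1968, Ch. I §1.2] -/
theorem det_matrix_eq_one_of_forall_pow_eq_one (e : V.geomTorsion p ≃+ (Fin 2 → ZMod p))
    {σ : absoluteGaloisGroup ℚ} {M : Matrix (Fin 2) (Fin 2) (ZMod p)}
    (hσ : ∀ P : V.geomTorsion p, e (σ • P) = M.mulVec (e P))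
    (hfix : ∀ (n : ℕ) (t : AlgebraicClosure ℚ), t ^ p ^ n = 1 → σ • t = t) : M.det = 1 := by
  letI : Module (ZMod p) (V.geomTorsion p) := AddSubgroup.torsionBy.zmodModule
  have hp0 : (p : ℚ) ≠ 0 := Nat.cast_ne_zero.mpr (Fact.out : p.Prime).ne_zero
  -- `χ_p(σ) = 1`
  have hχ : GaloisRep.cyclotomicCharacter ℚ p σ = 1 := by
    rw [GaloisRep.cyclotomicCharacter_apply]
    exact cyclotomicCharacter_eq_one_of_forall_pow_eq_one p _ fun n t ht => hfix n t ht
  -- `det ρ_T(σ) = 1`, hence `det ρ̄(σ) = 1`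
  have hdetT : LinearMap.det (V.galoisRepTate p σ : V.tateModule p →ₗ[ℤ_[p]] V.tateModule p) = 1 := by
    rw [V.det_galoisRepTate_eq_cyclotomicCharacter_holds p hp0 σ, hχ, Units.val_one]
  have hdetbar : LinearMap.det ((galoisRepTorsion V p σ).toAdd.toAddMonoidHom.toZModLinearMap p) = 1 := by
    rw [V.det_galoisRepTorsion_eq_toZMod_det_galoisRepTate p hp0 σ, hdetT, map_one]
  -- the determinant of the linear map is that of its matrix in the frame `e`
  let eL : V.geomTorsion p ≃ₗ[ZMod p] (Fin 2 → ZMod p) :=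
    LinearEquiv.ofBijective (e.toAddMonoidHom.toZModLinearMap p) ⟨e.injective, e.surjective⟩
  have heL : ∀ Q : V.geomTorsion p, eL Q = e Q := fun _ ↦ rfl
  have hconj : Matrix.toLin' M =
      eL.conj ((galoisRepTorsion V p σ).toAdd.toAddMonoidHom.toZModLinearMap p) := by
    refine LinearMap.ext fun v ↦ ?_
    obtain ⟨Q, rfl⟩ := eL.surjective v
    rw [LinearEquiv.conj_apply_apply, eL.symm_apply_apply, heL, heL, Matrix.toLin'_apply]
    change M.mulVec (e Q) = e (σ • Q)
    rw [hσ]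
  rw [← LinearMap.det_toLin' M, hconj, LinearEquiv.conj_apply, LinearMap.comp_assoc, LinearMap.det_conj, hdetbar]

/-- **Dichotomy on `V[p]`**: on a curve whose mod-`p` image lies in `C_ns⁺(ε)` (`p ≠ 2`), a `σ` fixing `μ_{p^∞}` either acts
TRIVIALLY on `V[p]`, or `σ − 1` is ONTO `V[p]` (indeed invertible). [cite: Serre1972, §2.2] -/
theorem smul_eq_self_or_forall_exists_sub_eq_of_forall_pow_eq_one (hp2 : p ≠ 2)
    (h : HasNonsplitCartanModPImage V p) {σ : absoluteGaloisGroup ℚ}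
    (hfix : ∀ (n : ℕ) (t : AlgebraicClosure ℚ), t ^ p ^ n = 1 → σ • t = t) :
    (∀ P : V.geomTorsion p, σ • P = P) ∨
      ∀ Q : V.geomTorsion p, ∃ P : V.geomTorsion p, σ • P - P = Q := by
  obtain ⟨e, ε, hε, himg⟩ := h
  obtain ⟨M, hM, hMσ⟩ := himg σ
  have hdet := det_matrix_eq_one_of_forall_pow_eq_one V e hMσ hfix
  rcases eq_one_or_isUnit_sub_one_of_det_eq_one hp2 hε hM hdet with h1 | hU
  · left
    intro P
    apply e.injective
    rw [hMσ, h1, Matrix.one_mulVec]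
  · right
    obtain ⟨u, hu⟩ := hU
    intro Q
    refine ⟨e.symm ((↑u⁻¹ : Matrix (Fin 2) (Fin 2) (ZMod p)).mulVec (e Q)), e.injective ?_⟩
    rw [map_sub, hMσ, AddEquiv.apply_symm_apply]
    have hcalc : M.mulVec ((↑u⁻¹ : Matrix (Fin 2) (Fin 2) (ZMod p)).mulVec (e Q)) -
        (↑u⁻¹ : Matrix (Fin 2) (Fin 2) (ZMod p)).mulVec (e Q) =
          (M - 1).mulVec ((↑u⁻¹ : Matrix (Fin 2) (Fin 2) (ZMod p)).mulVec (e Q)) := by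
      rw [Matrix.sub_mulVec, Matrix.one_mulVec]
    rw [hcalc, ← hu, Matrix.mulVec_mulVec, ← Units.val_mul, mul_inv_cancel, Units.val_one, Matrix.one_mulVec]

end Torsion

/-! ## §3 The hypothesis of Kato's clause (3) fails on every row -/

/-- **Additive images of `ℤ_p` in a group of exponent `p` have at most `p` elements**: every `a ∈ ℤ_p` is
`a = r + p·b` with `0 ≤ r < p` (`PadicInt.zmodRepr`), so `F(a) = r • F(1)`. [folklore] -/
theorem card_le_of_addMonoidHom_surjective {G : Type*} [AddCommGroup G] [Finite G] (hG : ∀ x : G, p • x = 0)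
    (F : ℤ_[p] →+ G) (hF : Function.Surjective F) : Nat.card G ≤ p := by
  have hrange : ∀ y : G, ∃ k : Fin p, y = (k : ℕ) • F 1 := by
    intro y
    obtain ⟨a, rfl⟩ := hF y
    have hmem : a - (a.zmodRepr : ℤ_[p]) ∈ IsLocalRing.maximalIdeal ℤ_[p] := PadicInt.sub_zmodRepr_mem a
    rw [PadicInt.maximalIdeal_eq_span_p, Ideal.mem_span_singleton'] at hmem
    obtain ⟨b, hb⟩ := hmem
    refine ⟨⟨a.zmodRepr, PadicInt.zmodRepr_lt_p a⟩, ?_⟩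
    have ha : a = (a.zmodRepr : ℤ_[p]) + b * p := by rw [hb]; ring
    calc F a = F ((a.zmodRepr : ℤ_[p]) + b * p) := by rw [← ha]
      _ = F ((a.zmodRepr : ℕ) • (1 : ℤ_[p])) + F (p • b) := by
          rw [map_add, nsmul_eq_mul, mul_one, nsmul_eq_mul, mul_comm]
      _ = (a.zmodRepr : ℕ) • F 1 := by rw [map_nsmul, map_nsmul, hG, add_zero]
  have hsurj : Function.Surjective (fun k : Fin p => (k : ℕ) • F 1) := fun y => by
    obtain ⟨k, hk⟩ := hrange y
    exact ⟨k, hk.symm⟩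
  have := Nat.card_le_card_of_surjective _ hsurj
  simpa using this

section Kato

variable (V : WeierstrassCurve ℚ) [V.IsElliptic]

omit [V.IsElliptic] in
/-- Reduction of `(ρ(σ) − 1)a` to `V[p]`: `(σ − 1)` of the reduction. [cite: Kato2004Asterisque, §13.8 (p. 228)] -/
private theorem tateModP_sub (σ : absoluteGaloisGroup ℚ) (a : V.tateModule p) :
    tateModP V p ((V.galoisRepTate p σ - 1) a) = σ • tateModP V p a - tateModP V p a := by
  rw [LinearMap.sub_apply, Module.End.one_apply, map_sub, galoisRepTate_apply_apply, tateModP_smul]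

omit [V.IsElliptic] in
/-- The kernel of the reduction `T_pV → V[p]` is `p·T_pV` (half: `⊆`). [cite: SilvermanAEC2009, III.§7] -/
private theorem exists_eq_p_smul_of_tateModP_eq_zero {a : V.tateModule p} (ha : tateModP V p a = 0) :
    ∃ b : V.tateModule p, a = (p : ℤ_[p]) • b := by
  have h1 : TateModule.proj p 1 a = 0 := by
    have := congrArg (fun P : geomTorsion V (p : ℤ) => (P : geomPoints V)) ha
    simpa using this
  exact ⟨TateModule.div a h1, (TateModule.p_smul_div a h1).symm⟩

/-- The reduction `T_pV → V[p]` is onto. [cite: SilvermanAEC2009, III.§7] -/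
private theorem tateModP_surjective : Function.Surjective (tateModP V p) := by
  intro Q
  have hQ : (Q : geomPoints V) ∈ geomTorsion V (p ^ 1 : ℕ) := by rw [pow_one]; exact Q.2
  obtain ⟨a, ha⟩ := proj_surjective_of_isAlgClosed_holds V p 1 hQ
  exact ⟨a, Subtype.ext (by rw [coe_tateModP_apply, ha])⟩

/-- **The hypothesis of Kato's Thm. 13.4 clause (3) fails** whenever the mod-`p` image lies in `C_ns⁺(ε)` (`p ≠ 2`): there
is no `σ ∈ Γ_ℚ` fixing `μ_{p^∞}` with `T_pV/(ρ(σ) − 1)T_pV ≃ ℤ_p`. (Clause (3) of the vendored fact asks in addition for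
`V[p]` irreducible; the obstruction here is the free rank-one cokernel alone.) [cite: Kato2004Asterisque, Thm. 13.4 (3) (p. 226)]
[cite: Serre1972, §2.2] -/
theorem not_exists_katoClauseThree (hp2 : p ≠ 2) (h : HasNonsplitCartanModPImage V p) :
    ¬ ∃ σ : absoluteGaloisGroup ℚ,
      (∀ (n : ℕ) (t : AlgebraicClosure ℚ), t ^ p ^ n = 1 → σ • t = t) ∧
        Nonempty (((V.tateModule p) ⧸ LinearMap.range (V.galoisRepTate p σ - 1)) ≃ₗ[ℤ_[p]] ℤ_[p]) := by
  rintro ⟨σ, hfix, ⟨φ⟩⟩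
  have hp : p.Prime := Fact.out
  set N : Submodule ℤ_[p] (V.tateModule p) := LinearMap.range (V.galoisRepTate p σ - 1) with hN
  rcases smul_eq_self_or_forall_exists_sub_eq_of_forall_pow_eq_one V hp2 h hfix with htriv | honto
  · -- (i) `ρ̄(σ) = 1`: `N ≤ ker (T → V[p])`, so `ℤ_p ≅ T/N ↠ V[p]`, of order `p²`
    obtain ⟨e, -, -, -⟩ := h
    have hNker : ∀ x ∈ N.toAddSubgroup, tateModP V p x = 0 := by
      intro x hx
      obtain ⟨a, rfl⟩ : ∃ a, (V.galoisRepTate p σ - 1) a = x := LinearMap.mem_range.mp hx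
      rw [tateModP_sub, htriv, sub_self]
    let F₀ : (V.tateModule p ⧸ N.toAddSubgroup) →+ V.geomTorsion p :=
      QuotientAddGroup.lift N.toAddSubgroup (tateModP V p) hNker
    let F : ℤ_[p] →+ V.geomTorsion p := F₀.comp φ.symm.toLinearMap.toAddMonoidHom
    have hF : Function.Surjective F := by
      intro Q
      obtain ⟨a, ha⟩ := tateModP_surjective V (p := p) Q
      refine ⟨φ (Submodule.Quotient.mk a), ?_⟩
      change F₀ (φ.symm (φ (Submodule.Quotient.mk a))) = Q
      rw [φ.symm_apply_apply]
      exact ha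
    haveI : Finite (V.geomTorsion p) := Finite.of_equiv _ e.toEquiv.symm
    have hexp : ∀ x : V.geomTorsion p, p • x = 0 := by
      intro x
      letI : Module (ZMod p) (V.geomTorsion p) := AddSubgroup.torsionBy.zmodModule
      rw [← Nat.cast_smul_eq_nsmul (ZMod p), ZMod.natCast_self, zero_smul]
    have hle := card_le_of_addMonoidHom_surjective hexp F hF
    have hcard : Nat.card (V.geomTorsion p) = p ^ 2 := by
      rw [Nat.card_congr e.toEquiv, Nat.card_fun, Nat.card_zmod, Nat.card_eq_fintype_card, Fintype.card_fin]
    rw [hcard] at hle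
    have : p ^ 2 ≤ p ^ 1 := by rwa [pow_one]
    exact absurd (Nat.pow_le_pow_iff_right hp.one_lt |>.mp this) (by norm_num)
  · -- (ii) `ρ̄(σ) − 1` onto: `T = N + pT`, so `T/N = p·(T/N) ≅ ℤ_p`, i.e. `1 ∈ pℤ_p`
    have hdecomp : ∀ a : V.tateModule p, ∃ b c : V.tateModule p,
        a = (V.galoisRepTate p σ - 1) b + (p : ℤ_[p]) • c := by
      intro a
      obtain ⟨Q, hQ⟩ := honto (tateModP V p a)
      obtain ⟨b, hb⟩ := tateModP_surjective V (p := p) Q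
      have hz : tateModP V p (a - (V.galoisRepTate p σ - 1) b) = 0 := by
        rw [map_sub, tateModP_sub, hb, hQ, sub_self]
      obtain ⟨c, hc⟩ := exists_eq_p_smul_of_tateModP_eq_zero V hz
      exact ⟨b, c, by rw [← hc, add_sub_cancel]⟩
    have hone : ∃ y : ℤ_[p], (1 : ℤ_[p]) = (p : ℤ_[p]) * y := by
      obtain ⟨a, ha⟩ := Submodule.Quotient.mk_surjective N (φ.symm 1)
      obtain ⟨b, c, habc⟩ := hdecomp a
      refine ⟨φ (Submodule.Quotient.mk c), ?_⟩
      have hq' : φ.symm 1 = (p : ℤ_[p]) • Submodule.Quotient.mk (p := N) c := by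
        rw [← ha, habc, Submodule.Quotient.mk_add, Submodule.Quotient.mk_smul,
          (Submodule.Quotient.mk_eq_zero N).mpr (LinearMap.mem_range.mpr ⟨b, rfl⟩), zero_add]
      calc (1 : ℤ_[p]) = φ (φ.symm 1) := (φ.apply_symm_apply 1).symm
        _ = (p : ℤ_[p]) * φ (Submodule.Quotient.mk c) := by rw [hq', map_smul, smul_eq_mul]
    obtain ⟨y, hy⟩ := hone
    have hunit : IsUnit (p : ℤ_[p]) := isUnit_iff_exists_inv.mpr ⟨y, hy.symm⟩
    have hnorm := PadicInt.isUnit_iff.mp hunit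
    rw [PadicInt.norm_p] at hnorm
    have : (p : ℝ)⁻¹ < 1 := inv_lt_one_of_one_lt₀ (by exact_mod_cast hp.one_lt)
    exact absurd hnorm this.ne

/-- **On every row of crux 19606 the hypothesis of Kato's Thm. 13.4 clause (3) fails**: for `V/ℚ` globally minimal,
`p ≥ 5` good with `a_p = 0` and `p`-adic tower NOT onto, there is no `σ ∈ Gal(ℚ̄/ℚ(μ_{p^∞}))` with
`T_pV/(ρ(σ) − 1)T_pV ≃ ℤ_p`. The integral Euler-system bound at `(p)` is therefore unavailable BY ITS OWN HYPOTHESIS on these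
rows (the `μ`-part of the crux stays with (A) + analytic `μ`, skeleton v5/v7). [cite: Kato2004Asterisque, Thm. 13.4 (3) and the remark after it (p. 226)]
[cite: Serre1972, §1.11 Prop. 12, §2.2] -/
theorem not_exists_katoClauseThree_of_row [V.IsGloballyMinimal] (p : ℕ) [Fact p.Prime] (hp5 : 5 ≤ p)
    (hgood : V.HasGoodReductionAtPrime p) (hap : V.frobeniusTrace p = 0)
    (hns : ¬ ∀ m : ℕ, V.HasSurjectiveModNGaloisRep (p ^ m : ℕ)) :
    ¬ ∃ σ : absoluteGaloisGroup ℚ,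
      (∀ (n : ℕ) (t : AlgebraicClosure ℚ), t ^ p ^ n = 1 → σ • t = t) ∧
        Nonempty (((V.tateModule p) ⧸ LinearMap.range (V.galoisRepTate p σ - 1)) ≃ₗ[ℤ_[p]] ℤ_[p]) :=
  not_exists_katoClauseThree V (by omega)
    (hasModPImageEqNonsplitCartanNormalizer_of_row V p hp5 hgood hap hns).hasNonsplitCartanModPImage

end Kato

end Summit.BirchSwinnertonDyer.BirchSwinnertonDyer.Theorems.EtaCartanField

end
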